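import Mathlib

/-!
# Dispersion defect: the pointwise Cauchy–Schwarz bound `(ω_a + ω_b − ω_{a+b})² ≤ 4 ω_a ω_b`

Kernel K31 of the solo-blind programme (session s73; route K, the few-body dilute lattice corner —
`work/routeK/ROUTE_KJ_s59.md` §7, Lemma 7.2).  Mathlib only; nothing beyond `sin² + cos² = 1`
and the discriminant of a nonnegative real quadratic.

Setting.  On the torus `ℤ^d_L` the nearest-neighbour lattice dispersion is
`ω(a) = Σ_e (2 − 2 cos a_e)` (sum over the `d` lattice directions `e`; `a_e` the components of the
lattice momentum; `2 − 2cos θ = |e^{iθ} − 1|²`).  The *dispersion defect* of a pair of momenta,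
`C̃(a,b) := ω(a) + ω(b) − ω(a+b) = 2 Re Σ_e (e^{i a_e} − 1)(e^{i b_e} − 1)`,
is the vertex weight of the three-body (`sunset`) lattice sums `𝔄, 𝔄′` that control the Jastrow
test charge in Theorem B‴₃ (`|δ₃/(3δ₂) − 1| ≤ C (1 + log L)^{1/2} / L`, paper level).  Lemma 7.2
there is the pointwise bound `|C̃(a,b)| ≤ (Σ_e|e^{ia_e}−1|²)^{1/2} (Σ_e|e^{ib_e}−1|²)^{1/2}`, i.e.
`C̃(a,b)² ≤ 4 ω(a) ω(b)` in the `2 − 2cos` normalisation (it sharpens the constant of `𝔄` by 4: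
`𝔄′ ≤ (1+η_max)² μ′⁴ λ̃⁴ Y / 16`).

Results (edges `e` in an arbitrary finite set `s`, arbitrary real components — so every torus
`ℤ^d_L` and every `d` is covered by specialisation; no definitions are introduced).
* `edgeDefect_eq` — one direction: `(2−2cos α) + (2−2cos β) − (2−2cos(α+β))
   = 2((cos α − 1)(cos β − 1) − sin α sin β)` (= `2 Re (e^{iα}−1)(e^{iβ}−1)`);
* `edgeDefect_quadratic` — the tilted-square identity (polarised Lagrange identity in `ℝ²`)
  `t²(2−2cos α) − t·c(α,β) + (2−2cos β) = (t(cos α−1) − (cos β−1))² + (t sin α + sin β)²`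
  for every real `t`, hence `≥ 0`;
* `edgeDefect_sq_le` — `c(α,β)² ≤ 4 (2−2cos α)(2−2cos β)` (discriminant in `t`);
* `dispersionDefect_quadratic_nonneg`, `dispersionDefect_sq_le` — summing the tilted squares over
  the directions and taking the discriminant again:
  `(ω a + ω b − ω (a+b))² ≤ 4 · ω a · ω b`  (Lemma 7.2), with the corollaries
  `dispersionDefect_abs_le` (`|C̃| ≤ 2 √(ω a · ω b)`) and the substituted form
  `dispersionDefect_sq_le_sub` (`b = p − a`, the form used inside `𝔄′`).
Scope: an elementary inequality of the route-K lattice-sum calculus (few-body corner, fixed particle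
number); it carries no information about the conjunct at fixed density.
-/

namespace Summit.AtomisticToContinuum.BoseEinsteinCondensation.Theorems

section DispersionDefect

open Finset

/-- `0 ≤ 2 − 2 cos θ`. -/
theorem edgeFactor_nonneg (θ : ℝ) : 0 ≤ 2 - 2 * Real.cos θ := by
  have := Real.cos_le_one θ
  linarith

/-- `2 − 2cos θ = (cos θ − 1)² + sin² θ` (`= |e^{iθ} − 1|²`). -/
theorem edgeFactor_eq_sq (θ : ℝ) :
    2 - 2 * Real.cos θ = (Real.cos θ - 1) ^ 2 + Real.sin θ ^ 2 := by
  have h := Real.sin_sq_add_cos_sq θ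
  linear_combination (-1 : ℝ) * h

/-- The one-direction defect is twice the real part of `(e^{iα} − 1)(e^{iβ} − 1)`. -/
theorem edgeDefect_eq (α β : ℝ) :
    (2 - 2 * Real.cos α) + (2 - 2 * Real.cos β) - (2 - 2 * Real.cos (α + β))
      = 2 * ((Real.cos α - 1) * (Real.cos β - 1) - Real.sin α * Real.sin β) := by
  rw [Real.cos_add]
  ring

/-- **Tilted-square identity** (polarised Lagrange identity in `ℝ²`): for every real `t`,
`t² x_α − t c(α,β) + x_β = |t u − v|²` with `u = (cos α − 1, sin α)`, `v = (cos β − 1, −sin β)`. -/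
theorem edgeDefect_quadratic (α β t : ℝ) :
    t ^ 2 * (2 - 2 * Real.cos α)
        - t * ((2 - 2 * Real.cos α) + (2 - 2 * Real.cos β) - (2 - 2 * Real.cos (α + β)))
        + (2 - 2 * Real.cos β)
      = (t * (Real.cos α - 1) - (Real.cos β - 1)) ^ 2 + (t * Real.sin α + Real.sin β) ^ 2 := by
  rw [edgeDefect_eq, edgeFactor_eq_sq, edgeFactor_eq_sq]
  ring

/-- Hence the one-direction quadratic `t² x_α − t c(α,β) + x_β` is nonnegative for every `t`. -/
theorem edgeDefect_quadratic_nonneg (α β t : ℝ) :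
    0 ≤ t ^ 2 * (2 - 2 * Real.cos α)
        - t * ((2 - 2 * Real.cos α) + (2 - 2 * Real.cos β) - (2 - 2 * Real.cos (α + β)))
        + (2 - 2 * Real.cos β) := by
  rw [edgeDefect_quadratic]
  positivity

/-- **Per-direction Cauchy–Schwarz**: `c(α,β)² ≤ 4 (2 − 2cos α)(2 − 2cos β)`. -/
theorem edgeDefect_sq_le (α β : ℝ) :
    ((2 - 2 * Real.cos α) + (2 - 2 * Real.cos β) - (2 - 2 * Real.cos (α + β))) ^ 2
      ≤ 4 * ((2 - 2 * Real.cos α) * (2 - 2 * Real.cos β)) := by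
  have hd : discrim (2 - 2 * Real.cos α)
      (-((2 - 2 * Real.cos α) + (2 - 2 * Real.cos β) - (2 - 2 * Real.cos (α + β))))
      (2 - 2 * Real.cos β) ≤ 0 := by
    apply discrim_le_zero
    intro t
    have := edgeDefect_quadratic_nonneg α β t
    linarith
  unfold discrim at hd
  nlinarith [hd]

variable {ι : Type*}

/-- `0 ≤ ω(a) = Σ_{e ∈ s} (2 − 2 cos a_e)`. -/
theorem latticeDispersion_nonneg (s : Finset ι) (a : ι → ℝ) :
    0 ≤ ∑ e ∈ s, (2 - 2 * Real.cos (a e)) :=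
  Finset.sum_nonneg fun e _ => edgeFactor_nonneg (a e)

/-- The dispersion defect is the sum of the one-direction defects. -/
theorem dispersionDefect_eq_sum (s : Finset ι) (a b : ι → ℝ) :
    (∑ e ∈ s, (2 - 2 * Real.cos (a e))) + (∑ e ∈ s, (2 - 2 * Real.cos (b e)))
        - ∑ e ∈ s, (2 - 2 * Real.cos (a e + b e))
      = ∑ e ∈ s, ((2 - 2 * Real.cos (a e)) + (2 - 2 * Real.cos (b e))
          - (2 - 2 * Real.cos (a e + b e))) := by
  rw [← Finset.sum_add_distrib, ← Finset.sum_sub_distrib]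

/-- Summed tilted squares: `t² ω(a) − t C̃(a,b) + ω(b) ≥ 0` for every real `t`. -/
theorem dispersionDefect_quadratic_nonneg (s : Finset ι) (a b : ι → ℝ) (t : ℝ) :
    0 ≤ t ^ 2 * (∑ e ∈ s, (2 - 2 * Real.cos (a e)))
        - t * ((∑ e ∈ s, (2 - 2 * Real.cos (a e))) + (∑ e ∈ s, (2 - 2 * Real.cos (b e)))
                - ∑ e ∈ s, (2 - 2 * Real.cos (a e + b e)))
        + ∑ e ∈ s, (2 - 2 * Real.cos (b e)) := by
  rw [dispersionDefect_eq_sum, Finset.mul_sum, Finset.mul_sum, ← Finset.sum_sub_distrib,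
    ← Finset.sum_add_distrib]
  exact Finset.sum_nonneg fun e _ => edgeDefect_quadratic_nonneg (a e) (b e) t

/-- **Lemma 7.2 (dispersion defect, pointwise Cauchy–Schwarz).**
`(ω a + ω b − ω (a+b))² ≤ 4 · ω a · ω b` on every torus, in every dimension. -/
theorem dispersionDefect_sq_le (s : Finset ι) (a b : ι → ℝ) :
    ((∑ e ∈ s, (2 - 2 * Real.cos (a e))) + (∑ e ∈ s, (2 - 2 * Real.cos (b e)))
        - ∑ e ∈ s, (2 - 2 * Real.cos (a e + b e))) ^ 2
      ≤ 4 * ((∑ e ∈ s, (2 - 2 * Real.cos (a e))) * ∑ e ∈ s, (2 - 2 * Real.cos (b e))) := by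
  have hd : discrim (∑ e ∈ s, (2 - 2 * Real.cos (a e)))
      (-((∑ e ∈ s, (2 - 2 * Real.cos (a e))) + (∑ e ∈ s, (2 - 2 * Real.cos (b e)))
          - ∑ e ∈ s, (2 - 2 * Real.cos (a e + b e))))
      (∑ e ∈ s, (2 - 2 * Real.cos (b e))) ≤ 0 := by
    apply discrim_le_zero
    intro t
    have := dispersionDefect_quadratic_nonneg s a b t
    linarith
  unfold discrim at hd
  nlinarith [hd]

/-- The same bound with the absolute value: `|C̃(a,b)| ≤ 2 √(ω a · ω b)`. -/
theorem dispersionDefect_abs_le (s : Finset ι) (a b : ι → ℝ) :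
    |(∑ e ∈ s, (2 - 2 * Real.cos (a e))) + (∑ e ∈ s, (2 - 2 * Real.cos (b e)))
        - ∑ e ∈ s, (2 - 2 * Real.cos (a e + b e))|
      ≤ 2 * Real.sqrt ((∑ e ∈ s, (2 - 2 * Real.cos (a e)))
              * ∑ e ∈ s, (2 - 2 * Real.cos (b e))) := by
  have h := dispersionDefect_sq_le s a b
  have h4 : Real.sqrt (4 * ((∑ e ∈ s, (2 - 2 * Real.cos (a e)))
        * ∑ e ∈ s, (2 - 2 * Real.cos (b e))))
      = 2 * Real.sqrt ((∑ e ∈ s, (2 - 2 * Real.cos (a e)))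
          * ∑ e ∈ s, (2 - 2 * Real.cos (b e))) := by
    rw [Real.sqrt_mul (by norm_num : (0 : ℝ) ≤ 4)]
    congr 1
    rw [show (4 : ℝ) = 2 ^ 2 by norm_num, Real.sqrt_sq (by norm_num : (0 : ℝ) ≤ 2)]
  rw [← h4]
  exact Real.abs_le_sqrt h

/-- The substituted form used inside the sunset sum `𝔄′` (`b = p − a`):
`(ω a + ω (p−a) − ω p)² ≤ 4 · ω a · ω (p−a)`. -/
theorem dispersionDefect_sq_le_sub (s : Finset ι) (a p : ι → ℝ) :
    ((∑ e ∈ s, (2 - 2 * Real.cos (a e))) + (∑ e ∈ s, (2 - 2 * Real.cos (p e - a e)))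
        - ∑ e ∈ s, (2 - 2 * Real.cos (p e))) ^ 2
      ≤ 4 * ((∑ e ∈ s, (2 - 2 * Real.cos (a e)))
              * ∑ e ∈ s, (2 - 2 * Real.cos (p e - a e))) := by
  have h := dispersionDefect_sq_le s a (fun e => p e - a e)
  simp only [add_sub_cancel] at h
  exact h

end DispersionDefect

end Summit.AtomisticToContinuum.BoseEinsteinCondensation.Theorems
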